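import Summits.ResolutionOfSingularities.ResolutionOfSingularities.Theorems.PurelyInseparableDim4JointNoTransversalChild
import HarnessLib

/-!
# Purely inseparable four-folds: NO TRANSVERSAL CHILD, several SEPARATED members — the irreducibility step, done by an
# infinite-field pigeonhole (brick S3 (c) «joint point∘coordinate chains», part 26b, cell `res-dim4-pi`)

[OURS · counted 0] (D-0157 DOOR 2; desk WORD #66 (4)(c), #74 (g), #99 (d), desk 03:35Z ask «`no_transversal_child_of_separated_members`»;
frame `PIDim4.TerminationImpliesOrderReduction`, S3 (c); host item stmt-ResolutionOfSingularities-16155, helper). Nothing here proves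
resolution of singularities in dimension ≥ 4 / characteristic `p` — NOT here, not anywhere in this programme.

Part 26 (`no_transversal_child`) assumed that the blown-up member `V(z, x_S)` carries EVERY root parameter. Here the root configuration
has finitely many pairwise SEPARATED members `(b″, S″)` (translated coordinate subspaces, as in the root forms p675540 / p679262 / p683579),
one of which is `(0, S)`, together carrying every root parameter:

* **`no_transversal_child_of_separated_members`** — still NO `S′ ∌ j` is permissible for a child state `step p S j b (F, 0, ∅)` of the
  member `(0, S)`. PROOF: on the re-centred `x_j`-chart the points `z̃ = 0`, `x_{S′} = 0`, `x_j = t` of `V(z̃, x_{S′})` (`t ∈ K`) have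
  order `≥ p`; for `t ≠ 0` they lie off the exceptional divisor, over the root points `(x_j = t, x_i = t·b_i (i ∈ S∖j), x_i = b_i (i ∉ S))`
  — a punctured LINE of root parameters. A member containing the point for parameter `t` pins `t` to one of finitely many values
  (`b″_j` if `j ∈ S″`; `b″_i / b_i` for the separating coordinate otherwise), so some `t` in the infinite field `K` escapes every member.

With this, the ROUTES qualifier «for single-covering-member roots» on the v2 honest-scope sentence can be dropped: the joint forest v2
+ normalised cover handles every non-escaping child for ALL root configurations of its frame. AI-produced formalisation, weaker
than expert review. bears_on: LADDER-RESOLUTION:D157-DOOR2 (res-dim4-pi · S3 (c) joint v2 · scope, several members).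
-/

set_option linter.dupNamespace false -- D-0017: single-problem summit path `Summit.<S>.<S>.…` by design

noncomputable section

open MvPolynomial Finset CategoryTheory AlgebraicGeometry Opposite TopologicalSpace
open AlgebraicGeometry.Scheme.IdealSheafData (ofIdealTop vanishingIdeal)

namespace Summit.ResolutionOfSingularities.ResolutionOfSingularities.Theorems.PIDim4

open Literature.AlgebraicGeometry.Resolution
open Literature.AlgebraicGeometry.Resolution.Hauser2010
open Literature.AlgebraicGeometry.Resolution.AffinePointBlowup (P A γ coord Wtop ξ)

namespace Equimultiple

section NoTransversalMembers

variable {K : Type} [Field K] {p : ℕ} [hp : Fact p.Prime] [CharP K p]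

/-- **The punctured line of root points below a transversal child.** On the re-centred `x_j`-chart of a blow-up of `𝔸⁵` along
`V(z, x_S)` (chart point `b`, `b_j = 0`), if `V(z̃, x_{S′})` with `j ∉ S′` is permissible for the transform, then for every `t ≠ 0` the
parameter `u(t) = (x_j = t, x_i = t·b_i (i ∈ S ∖ j), x_i = b_i (i ∉ S))` is a root parameter of `z^p + F` (every non-constant monomial
of degree `< p` of `F(x + u(t))` vanishes). [cite: Hauser2010, §F] [cite: GortzWedhorn2020, Prop. 13.91 (3)] -/
theorem root_parameter_line_of_transversal [IsAlgClosed K] [DecidableEq K] (F : MvPolynomial (Fin 4) K) {S : Finset (Fin 4)}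
    (hperm : (p : ℕ∞) ≤ CentreBlowup.ordAlong S F) {j : Fin 4} (hj : j ∈ S) (b : Fin 4 → K) (hbj : b j = 0)
    {S' : Finset (Fin 4)} (hjS' : j ∉ S')
    (hperm' : (p : ℕ∞) ≤ CentreBlowup.ordAlong S' (CentreBlowup.step p S j b (⟨F, 0, ∅⟩ : State K)).F) (t : K) (ht : t ≠ 0) :
    ∀ d : Fin 4 →₀ ℕ, d ≠ 0 → d.degree < p →
      coeff d (PointBlowup.translate (fun i => if i = j then t else if i ∈ S then t * b i else b i) F) = 0 := by
  classical
  haveI : PerfectRing K p := PerfectRing.ofSurjective K p fun x => IsAlgClosed.exists_pow_nat_eq x hp.out.pos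
  set Λ : Set (Fin (4 + 1)) := insert 0 (Fin.succ '' (S : Set (Fin 4))) with hΛ
  set B := blowup.π (AffineCoordBlowup.𝓘Λ 4 K Λ) with hBdef
  have hB : IsBlowup B (AffineCoordBlowup.𝓘Λ 4 K Λ) := blowup.isBlowup _
  obtain ⟨Θ, h, h0, hs, hc⟩ :=
    ChartDictionary.controlledTransform_chart_eq_step p hj hbj (⟨F, 0, ∅⟩ : State K) hperm hB
  haveI := isOpenImmersion_specMap_algEquiv Θ
  -- the rational point `z̃ = 0`, `x_i = 0` (`i ≠ j`), `x_j = t` of the cleaned chart lies on `V(z̃, x_{S'})`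
  let c : Fin 4 → K := fun i => if i = j then t else 0
  have hcj : c j = t := if_pos rfl
  have hci : ∀ i, i ≠ j → c i = 0 := fun i hi => if_neg hi
  have hcS' : ∀ i ∈ S', c i = 0 := fun i hi => hci i fun h' => hjS' (h' ▸ hi)
  let y : P 4 K := ⟨MvPolynomial.vanishingIdeal K {(Fin.cons 0 c : Fin (4 + 1) → K)}, inferInstance⟩
  have hyC : y ∈ AffineCoordBlowup.CΛ 4 K (insert 0 (Fin.succ '' (S' : Set (Fin 4)))) := mem_CΛ_of_cons rfl rfl hcS'
  have h1 : (p : ℕ∞) ≤ idealOrder (hypSheaf p (CentreBlowup.step p S j b (⟨F, 0, ∅⟩ : State K)).F) y :=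
    ChartDictionary.le_idealOrder_hypSheaf_of_mem_CΛ p S' _ hperm' hyC
  rw [← hc, idealOrder_comap_of_isOpenImmersion] at h1
  -- off the exceptional divisor
  set r : P 4 K := Spec.map (CommRingCat.ofHom (Θ : A 4 K →+* A 4 K)) y with hr
  have hXj : (X j.succ : A 4 K) ∉ r.asIdeal := by
    rw [hr, Spec.map_apply, PrimeSpectrum.comap_asIdeal, Ideal.mem_comap, CommRingCat.hom_ofHom]
    change Θ (X j.succ) ∉ MvPolynomial.vanishingIdeal K {(Fin.cons 0 c : Fin (4 + 1) → K)}
    rw [hs j, MvPolynomial.mem_vanishingIdeal_singleton_iff, map_add, aeval_X, aeval_C, Fin.cons_succ, hcj, hbj]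
    simpa using ht
  have hnot : B (AffineCoordBlowup.chartImm hB (ChartDictionary.succ_mem_centreVars hj) r) ∉
      ((AffineCoordBlowup.𝓘Λ 4 K Λ).support : Set (P 4 K)) := by
    rw [AffineCoordBlowup.support_𝓘Λ]
    exact fun hmem => hXj ((π_chartImm_mem_CΛ_iff hB hj r).mp hmem)
  have h2 : (p : ℕ∞) ≤ idealOrder (hypSheaf p F) (B (AffineCoordBlowup.chartImm hB (ChartDictionary.succ_mem_centreVars hj) r)) := by
    rw [← idealOrder_controlledTransform_eq_of_eq_of_not_mem_support hB hnot (hypSheaf p F) p rfl]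
    exact h1
  -- coordinates of the image
  set Ψ : A 4 K →ₐ[K] A 4 K := (Θ : A 4 K →ₐ[K] A 4 K).comp (coordBlowupSubst K Λ j.succ) with hΨ
  have hcomp : Spec.map (CommRingCat.ofHom (Θ : A 4 K →+* A 4 K)) ≫
      AffineCoordBlowup.chartImm hB (ChartDictionary.succ_mem_centreVars hj) ≫ B = Spec.map (CommRingCat.ofHom Ψ.toRingHom) := by
    rw [AffineCoordBlowup.chartImm_comp, ← Spec.map_comp, ← CommRingCat.ofHom_comp]
    rfl
  set u : Fin (4 + 1) → K := fun m => aeval (Fin.cons 0 c : Fin (4 + 1) → K) (Ψ (X m)) with hu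
  have hBw : (B (AffineCoordBlowup.chartImm hB (ChartDictionary.succ_mem_centreVars hj) r)).asIdeal =
      MvPolynomial.vanishingIdeal K {(Fin.cons (u 0) (fun i => u i.succ) : Fin (4 + 1) → K)} := by
    have hpt : B (AffineCoordBlowup.chartImm hB (ChartDictionary.succ_mem_centreVars hj) r) =
        (Spec.map (CommRingCat.ofHom Ψ.toRingHom)) y := by
      rw [hr, ← Scheme.Hom.comp_apply, ← Scheme.Hom.comp_apply, ← hcomp]
    rw [hpt, specMap_comp_apply_pt Ψ (Fin.cons 0 c) y rfl]
    congr 2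
    funext m
    refine Fin.cases rfl (fun i => rfl) m
  -- the `x`-coordinates of the image: `t`, `t·b_i`, `b_i`
  have hux : (fun i => u i.succ) = fun i => if i = j then t else if i ∈ S then t * b i else b i := by
    funext i
    rw [hu]
    change aeval (Fin.cons 0 c : Fin (4 + 1) → K) (Θ (coordBlowupSubst K Λ j.succ (X i.succ))) = _
    by_cases hij : i = j
    · subst hij
      rw [coordBlowupSubst_X_self, hs i, map_add, aeval_X, aeval_C, Fin.cons_succ, hcj, hbj, if_pos rfl]
      simp
    · by_cases hiS : i ∈ S
      · rw [coordBlowupSubst_X_of_mem_of_ne K _ j.succ (ChartDictionary.succ_mem_centreVars hiS)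
          (fun h' => hij (Fin.succ_inj.mp h')), map_mul, hs j, hs i, map_mul, map_add, map_add, aeval_X, aeval_X, aeval_C, aeval_C,
          Fin.cons_succ, Fin.cons_succ, hcj, hbj, hci i hij, if_neg hij, if_pos hiS]
        simp
      · rw [coordBlowupSubst_X_of_not_mem K _ j.succ (ChartDictionary.succ_not_mem_centreVars hiS), hs i, map_add, aeval_X, aeval_C,
          Fin.cons_succ, hci i hij, if_neg hij, if_neg hiS]
        simp
  have hord := (natCast_le_idealOrder_hypSheaf_iff (p := p) F hBw p).mp h2
  rw [natCast_le_ordZero_translate_hyp_iff, hux] at hord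
  exact hord.2

/-- **NO TRANSVERSAL CHILD, SEVERAL SEPARATED MEMBERS.** See the module docstring. [cite: Hauser2010, §F (equiconstant points)]
[cite: GortzWedhorn2020, Prop. 13.91 (3)] [cite: HauserPerlega2019PRIMS, §2 (permissible centres P = (z, x_i : i ∈ Γ))] -/
theorem no_transversal_child_of_separated_members [IsAlgClosed K] [DecidableEq K] (F : MvPolynomial (Fin 4) K)
    {S : Finset (Fin 4)} (hperm : (p : ℕ∞) ≤ CentreBlowup.ordAlong S F) (mem : Finset ((Fin 4 → K) × Finset (Fin 4)))
    (h0 : ((0 : Fin 4 → K), S) ∈ mem)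
    (hsep : ∀ bS ∈ mem, ∀ bS' ∈ mem, bS ≠ bS' → ∃ i ∈ bS.2, i ∈ bS'.2 ∧ bS.1 i ≠ bS'.1 i)
    (hroots : ∀ b' : Fin 4 → K, (∀ d : Fin 4 →₀ ℕ, d ≠ 0 → d.degree < p → coeff d (PointBlowup.translate b' F) = 0) →
      ∃ bS ∈ mem, ∀ i ∈ bS.2, b' i = bS.1 i)
    {j : Fin 4} (hj : j ∈ S) (b : Fin 4 → K) (hbj : b j = 0) {S' : Finset (Fin 4)} (hjS' : j ∉ S') :
    ¬ (p : ℕ∞) ≤ CentreBlowup.ordAlong S' (CentreBlowup.step p S j b (⟨F, 0, ∅⟩ : State K)).F := by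
  classical
  intro hperm'
  -- the finitely many parameters `t` a member can pin
  let bad : Finset K := insert 0 (mem.biUnion fun bS => insert (bS.1 j) (S.image fun i => bS.1 i / b i))
  obtain ⟨t, ht⟩ := Infinite.exists_notMem_finset bad
  have ht0 : t ≠ 0 := fun h => ht (h ▸ Finset.mem_insert_self _ _)
  have hmem_bad : ∀ bS ∈ mem, bS.1 j ∈ bad ∧ ∀ i ∈ S, bS.1 i / b i ∈ bad := fun bS hbS =>
    ⟨Finset.mem_insert_of_mem (Finset.mem_biUnion.mpr ⟨bS, hbS, Finset.mem_insert_self _ _⟩),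
      fun i hi => Finset.mem_insert_of_mem (Finset.mem_biUnion.mpr ⟨bS, hbS,
        Finset.mem_insert_of_mem (Finset.mem_image.mpr ⟨i, hi, rfl⟩)⟩)⟩
  -- the root parameter `u(t)` and the member containing it
  have H := root_parameter_line_of_transversal F hperm hj b hbj hjS' hperm' t ht0
  obtain ⟨bS, hbS, hagree⟩ := hroots _ H
  by_cases hbS0 : bS = ((0 : Fin 4 → K), S)
  · -- the blown-up member itself: `x_j = t ≠ 0`
    subst hbS0
    have := hagree j hj
    simp only [ite_true, Pi.zero_apply] at this
    exact ht0 this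
  · obtain ⟨i, hi0, hiS'', hne⟩ := hsep _ h0 _ hbS (Ne.symm hbS0)
    -- `i ∈ S ∩ S″` separates `(0, S)` from `bS`: `0 ≠ bS.1 i`
    simp only [Pi.zero_apply] at hne
    by_cases hjS'' : j ∈ bS.2
    · -- `t = b″_j ∈ bad`
      have := hagree j hjS''
      simp only [ite_true] at this
      exact ht (this ▸ (hmem_bad bS hbS).1)
    · have hij : i ≠ j := fun h => hjS'' (h ▸ hiS'')
      have := hagree i hiS''
      simp only [if_neg hij, if_pos hi0] at this
      -- `t · b_i = b″_i ≠ 0`, so `t = b″_i / b_i ∈ bad`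
      have hbi : b i ≠ 0 := fun h => hne (by rw [← this, h, mul_zero])
      have htval : t = bS.1 i / b i := by rw [← this, mul_div_cancel_right₀ _ hbi]
      exact ht (htval ▸ (hmem_bad bS hbS).2 i hi0)

end NoTransversalMembers

end Equimultiple

end Summit.ResolutionOfSingularities.ResolutionOfSingularities.Theorems.PIDim4

end
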